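import Literature.RepresentationTheory.FiniteGroups.KroneckerSignedBinaryCubes
import Literature.NumberTheory.DiophantineGeometry.KroneckerPointSets
import Literature.NumberTheory.DiophantineGeometry.KroneckerRectangularStability
import Literature.Computability.AlgebraicComplexity.BI17Ex56SmallCases
import HarnessLib

/-!
# The complement symmetry `k_m(δ) = k_{δ²-m}(δ)` of the rectangular Kronecker coefficients, and
# the `δ = 4` block of Bürgisser–Ikenmeyer 2017, Ex. 5.6 / Rem. 5.18

Topic `Literature/Computability/AlgebraicComplexity`; theorem-only companion of
`BI17FundamentalInvariantTensors.lean` (named fact `BI2017_ex_5_6`) and `BI17Ex56SmallCases.lean`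
(cell val-lit, unit val-lit-p4 g6). NO new facts, NO definitions.

P. Bürgisser, C. Ikenmeyer, *Fundamental invariants of orbit closures*, J. Algebra 477 (2017)
390–434 = arXiv:1511.02927, §5: `k_m(δ) = g(m × δ, m × δ, m × δ)` (the tree's `kronRect ℂ m δ`),
`E(m) = {mδ : k_m(δ) > 0}` (`genericTensorDegreeMonoid_eq_kronRect`), Ex. 5.6 and Rem. 5.18
(Derksen-program values, held text p. 18 L125–139 and p. 21 L52–60): "`E'(10) = E'(11) = E'(12) =
{0,4,5,6,7,…}` and hence `e'(10) = e'(11) = e'(12) = 4`. Further, `e'(13) = e'(14) = e'(15) = e'(16)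
= 4`"; "`k_m(e'(m)) = 1` for `m = 2,3,4,5,6,8,9,14,15,16`, but `k_7(4) = 14`, and `k_{10}(4) = 13`,
`k_{11}(4) = 6`, `k_{12}(e'(12)) = 5`, `k_{13}(e'(13)) = 2`".

## What is proved

* `kronRect_eq_signedBinaryCubeCount`: `k_m(δ)` is the signed count of `0`-`1` arrays in the cube
  `[δ]³` with `mδ` ones and all slice margins `m + ρ - τρ` (the tree's
  `kroneckerCoeff_eq_signedBinaryCubeCount` = Ikenmeyer–Mulmuley–Walter 2017 Lemma 2.1–2.2 in
  alternant form, at `λ = μ = ν = m × δ` after `g(λ,μ,ν) = g(λ, μᵀ, νᵀ)`).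
* **`kronRect_eq_kronRect_of_add_eq_sq`: `k_m(δ) = k_{m'}(δ)` whenever `m + m' = δ²`** — the
  COMPLEMENT SYMMETRY (complementing the array in the cube; representation-theoretically
  `Λ^{mδ}(W) ≅ Λ^{δ³-mδ}(W)^* ⊗ det W`, `W = ℂ^δ ⊗ ℂ^δ ⊗ ℂ^δ`, in IMW's model
  `k_m(δ) = [Λ^{mδ}(W) : det^m ⊠ det^m ⊠ det^m]`).
* The `δ = 4` block of Ex. 5.6 / Rem. 5.18 as THEOREMS: `k_10(4) = 13`, `k_11(4) = 6`, `k_12(4) = 5`,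
  `k_13(4) = 2`, `k_14(4) = 1`, `k_15(4) = 1` (from `k_6(4) = 13`, `k_5(4) = 6`, `k_4(4) = 5`,
  `k_3(4) = 2`, `k_2(4) = 1`, `k_1(4) = 1`, kernel certificates of the tree's Murnaghan–Nakayama
  evaluator in `S_24, S_20, S_16, S_12, S_8, S_4` — instead of `S_40 … S_60`), `k_9(4) = k_7(4) = 14`;
  hence **`e(10) = 40`, `e(11) = 44`, `e(12) = 48`, `e(13) = 52`, `e(14) = 56`, `e(15) = 60`**
  (`BI2017_ex_5_6_ten` … `BI2017_ex_5_6_fifteen`), the complete value list of Rem. 5.18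
  (`BI2017_rem_5_18_values` = the last conjunct of `BI2017_ex_5_6` verbatim), and the reduction
  `BI2017_ex_5_6_of_shape`: the named fact now follows from its shape clause for `7 ≤ m ≤ 12` alone.

Honest framing: kernel-checked bookkeeping of published Derksen-program values via classical
character theory; the shape clause of Ex. 5.6 for `7 ≤ m ≤ 12` (atoms `k_7(5), k_7(6), k_8(4),
k_8(5), k_9(5), k_m(5..7)` for `m = 10, 11, 12`) stays open here; nothing in this file bears on
VP versus VNP.

## References
* [BurgisserIkenmeyer2017] P. Bürgisser, C. Ikenmeyer, J. Algebra 477 (2017), §5, Ex. 5.6,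
  Rem. 5.18 (arXiv:1511.02927 pp. 18, 21).
* [IkenmeyerMulmuleyWalter2017] C. Ikenmeyer, K. D. Mulmuley, M. Walter, Comput. Complexity 26
  (2017), Lemma 2.1–2.2 (arXiv p. 7).
* [LiZhangXia2021] X. Li, L. Zhang, H. Xia, *Two classes of minimal generic fundamental invariants
  for tensors*, arXiv:2111.07343, Thm. 3.1 (the complement symmetry and `δ(n²-j) = n`, `j ≤ 3`).
* [AmanovYeliussizov2022] A. Amanov, D. Yeliussizov, *Fundamental invariants of tensors, Latin
  hypercubes, and rectangular Kronecker coefficients*, IMRN 2023 = arXiv:2202.11059, Thm. 5.1 (ii)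
  (symmetry), Cor. 5.5 and the table of `g_3(n,4)`, `n ≤ 16` (the values `k_m(4)` below, in print).
  (Both located by val-lit-t08 g6 after the first version of this file landed.)

## Mathlib and tree
Tree: `kronRect` (`BI17FundamentalInvariantTensors`); `kroneckerCoeff_eq_signedBinaryCubeCount`,
`signedBinaryCubeCount_const_eq_of_add_eq_sq` (`KroneckerSignedBinaryCubes`);
`kroneckerCoeff_transpose` (`SymmetricGroupRepsSignTwist`); `getD_sortedParts_transpose`
(`KroneckerPointSets`); `mem_youngDiagram_rectangle_iff` (`KroneckerRectangularStability`);
`Ex55.kronRect_eq_of_kronSum_eq`, `kronRect_three_four` (`BI17Ex55KroneckerTable`),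
`kronRect_seven_four`, `kronRect_five_three/_six_three/_eight_three`,
`genericTensorMinimalDegree_eq_of_kronRect_pos`, `BI2017_ex_5_6_three … _nine, _sixteen`,
`BI2017_rem_5_18_squares` (`BI17Ex56SmallCases`, `BI17SL3InvariantDimensionProofs`). Mathlib:
`YoungDiagram.rowLen/colLen/transpose`.

Provenance: val-lit cell, prover val-lit-p4 g6 (E1 δ = 4 block, lead-bip RULINGS #33).
-/

open _root_.Literature.NumberTheory.DiophantineGeometry
open _root_.Literature.RepresentationTheory.FiniteGroups
open _root_.Literature.RepresentationTheory.FiniteGroups.MNEval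

namespace Literature.Computability.AlgebraicComplexity

open Ex55

/-! ### 1. The rectangle `m × δ` and its transpose -/

section Rectangle

variable (m δ : ℕ)

/-- The first row of the rectangle `m × δ = (δ, …, δ)` has length at most `δ`.
[cite: BurgisserIkenmeyer2017, §5 (before eq. (5.2))] -/
theorem rowLen_zero_youngDiagram_rectangle_le :
    (Nat.Partition.rectangle m δ).youngDiagram.rowLen 0 ≤ δ := by
  by_contra h
  have hmem : (0, δ) ∈ (Nat.Partition.rectangle m δ).youngDiagram :=
    YoungDiagram.mem_iff_lt_rowLen.mpr (not_le.mp h)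
  rw [mem_youngDiagram_rectangle_iff] at hmem
  exact lt_irrefl δ hmem.2

/-- The transpose `(m^δ)` of the rectangle `m × δ = (δ^m)` has at most `δ` parts.
[cite: BurgisserIkenmeyer2017, §5 (before eq. (5.2))] -/
theorem card_parts_transpose_rectangle_le :
    (Nat.Partition.rectangle m δ).transpose.parts.card ≤ δ := by
  rw [← Nat.Partition.length_sortedParts, Nat.Partition.sortedParts_transpose,
    YoungDiagram.length_rowLens, YoungDiagram.colLen_transpose]
  exact rowLen_zero_youngDiagram_rectangle_le m δ

/-- The zero-padded parts of the transpose of the rectangle `m × δ` are `δ` copies of `m`: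
`(δ^m)ᵀ = (m^δ)`. [cite: BurgisserIkenmeyer2017, §5 (before eq. (5.2))] -/
theorem getD_sortedParts_transpose_rectangle (j : Fin δ) :
    (Nat.Partition.rectangle m δ).transpose.sortedParts.getD j 0 = m := by
  rw [getD_sortedParts_transpose]
  refine eq_of_forall_lt_iff fun i => ?_
  rw [← YoungDiagram.mem_iff_lt_colLen, mem_youngDiagram_rectangle_iff]
  exact ⟨fun h => h.1, fun h => ⟨h, j.2⟩⟩

end Rectangle

/-! ### 2. `k_m(δ)` as a signed count of binary arrays, and the complement symmetry -/

section Complement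

/-- **`k_m(δ)` is a signed count of binary arrays in the cube `[δ]³`**:
`k_m(δ) = Σ_{τ₁,τ₂,τ₃ ∈ 𝔖_δ} sgn · #{S ⊆ [δ]³ : #S = mδ, every slice margin m + ρ - τᵢρ}`
(`g(R,R,R) = g(R, Rᵀ, Rᵀ)` for `R = m × δ`, then the tree's alternant form of IMW Lemma 2.1–2.2
with `N = δ`, the three margin partitions being `Rᵀ = (m^δ)`).
[cite: IkenmeyerMulmuleyWalter2017, Lemma 2.1–2.2 (arXiv p. 7)] -/
theorem kronRect_eq_signedBinaryCubeCount (m δ : ℕ) :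
    (kronRect ℂ m δ : ℤ) =
      signedBinaryCubeCount δ (m * δ) (fun _ => m) (fun _ => m) (fun _ => m) := by
  unfold kronRect
  rw [kroneckerCoeff_transpose ℂ (Nat.Partition.rectangle m δ) (Nat.Partition.rectangle m δ)
      (Nat.Partition.rectangle m δ),
    kroneckerCoeff_eq_signedBinaryCubeCount (N := δ) _ _ _ (card_parts_transpose_rectangle_le m δ)
      (card_parts_transpose_rectangle_le m δ) (card_parts_transpose_rectangle_le m δ)]
  simp only [getD_sortedParts_transpose_rectangle]

/-- **Complement symmetry of the rectangular Kronecker coefficients: `k_m(δ) = k_{m'}(δ)` for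
`m + m' = δ²`** (in particular `k_m(δ) = k_{δ²-m}(δ)` for `m ≤ δ²`): complement the `0`-`1` array in
the cube `[δ]³` (`signedBinaryCubeCount_const_eq_of_add_eq_sq`). Representation-theoretically this
is `Λ^{mδ}(W) ≅ Λ^{δ³-mδ}(W)^* ⊗ det W` for `W = ℂ^δ ⊗ ℂ^δ ⊗ ℂ^δ` in IMW's model
`k_m(δ) = [Λ^{mδ}(W) : det^m ⊠ det^m ⊠ det^m]_{GL_δ³}`; the values of BI 2017 Rem. 5.18 exhibit it
(`k_m(4) = k_{16-m}(4)`). IN PRINT (located by val-lit-t08 g6 after this file landed): Ikenmeyer's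
thesis 2012 box complement `k(λ,μ,ν) = k(n²×n-λ, n²×n-μ, n²×n-ν)` quoted in BI 2017, proof of
Thm. 5.9 (3); Li–Zhang–Xia 2021 Thm. 3.1 "`k_{n²-j}(n) = k_j(n)` for `0 ≤ j ≤ n²`";
Amanov–Yeliussizov 2022 Thm. 5.1 (ii) "`g_d(n,k) = g_d(k^{d-1}-n, k)`" (`d = 3`). The proof here is
independent (signed binary cubes on the `𝔖_D` side).
[cite: LiZhangXia2021, Thm. 3.1] [cite: AmanovYeliussizov2022, Thm. 5.1 (ii)]
[cite: IkenmeyerMulmuleyWalter2017, Lemma 2.1–2.2 (arXiv p. 7)] -/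
theorem kronRect_eq_kronRect_of_add_eq_sq {m m' δ : ℕ} (h : m + m' = δ * δ) :
    kronRect ℂ m δ = kronRect ℂ m' δ := by
  have h1 := kronRect_eq_signedBinaryCubeCount m δ
  have h2 := kronRect_eq_signedBinaryCubeCount m' δ
  rw [signedBinaryCubeCount_const_eq_of_add_eq_sq h] at h1
  exact_mod_cast h1.trans h2.symm

/-- `k_m(δ) = k_{δ²-m}(δ)` for `m ≤ δ²` (Li–Zhang–Xia 2021 Thm. 3.1; Amanov–Yeliussizov 2022
Thm. 5.1 (ii)). [cite: LiZhangXia2021, Thm. 3.1] -/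
theorem kronRect_eq_kronRect_sq_sub {m δ : ℕ} (h : m ≤ δ * δ) :
    kronRect ℂ m δ = kronRect ℂ (δ * δ - m) δ :=
  kronRect_eq_kronRect_of_add_eq_sq (by omega)

end Complement

/-! ### 3. The small values `k_1(4), k_2(4), k_4(4), k_5(4), k_6(4)` (kernel certificates) -/

section SmallValues

/-- **`k_1(4) = 1`** (`g((4),(4),(4)) = 1`; `S_4`). [cite: BurgisserIkenmeyer2017, Rem. 5.18] -/
theorem kronRect_one_four : kronRect ℂ 1 4 = 1 :=
  kronRect_eq_of_kronSum_eq 1 (by norm_num) (by decide +kernel)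

/-- **`k_2(4) = 1`** (Rem. 5.4: `E(2) = 4ℕ` with all `k_2 ≤ 1`; kernel certificate in `S_8`).
[cite: BurgisserIkenmeyer2017, Rem. 5.4] -/
theorem kronRect_two_four : kronRect ℂ 2 4 = 1 :=
  kronRect_eq_of_kronSum_eq 1 (by norm_num) (by decide +kernel)

set_option maxHeartbeats 100000000 in
set_option maxRecDepth 100000 in
/-- **`k_4(4) = 5`** (kernel certificate of the tree's Murnaghan–Nakayama evaluator in `S_16`;
`= k_12(4)` of Rem. 5.18 by the complement symmetry). [cite: BurgisserIkenmeyer2017, Rem. 5.18] -/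
theorem kronRect_four_four : kronRect ℂ 4 4 = 5 :=
  kronRect_eq_of_kronSum_eq 5 (by norm_num) (by decide +kernel)

set_option maxHeartbeats 100000000 in
set_option maxRecDepth 100000 in
/-- **`k_5(4) = 6`** (kernel certificate in `S_20`; `= k_11(4)` of Rem. 5.18 by the complement
symmetry). [cite: BurgisserIkenmeyer2017, Rem. 5.18] -/
theorem kronRect_five_four : kronRect ℂ 5 4 = 6 :=
  kronRect_eq_of_kronSum_eq 6 (by norm_num) (by decide +kernel)

set_option maxHeartbeats 100000000 in
set_option maxRecDepth 100000 in
/-- **`k_6(4) = 13`** (kernel certificate in `S_24`; `= k_10(4)` of Rem. 5.18 by the complement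
symmetry). [cite: BurgisserIkenmeyer2017, Rem. 5.18] -/
theorem kronRect_six_four : kronRect ℂ 6 4 = 13 :=
  kronRect_eq_of_kronSum_eq 13 (by norm_num) (by decide +kernel)

end SmallValues

/-! ### 4. Rem. 5.18, the `δ = 4` block: `k_10(4), …, k_15(4)` and `k_9(4)` -/

section RemFiveEighteen

/-- **BI 2017 Rem. 5.18: `k_10(4) = 13` — PROVED** (`= k_6(4)`, complement symmetry in the
`4 × 4 × 4` cube). [cite: BurgisserIkenmeyer2017, Rem. 5.18] -/
theorem kronRect_ten_four : kronRect ℂ 10 4 = 13 := by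
  rw [kronRect_eq_kronRect_of_add_eq_sq (m' := 6) (δ := 4) (by norm_num), kronRect_six_four]

/-- **BI 2017 Rem. 5.18: `k_11(4) = 6` — PROVED** (`= k_5(4)`). [cite: BurgisserIkenmeyer2017, Rem. 5.18] -/
theorem kronRect_eleven_four : kronRect ℂ 11 4 = 6 := by
  rw [kronRect_eq_kronRect_of_add_eq_sq (m' := 5) (δ := 4) (by norm_num), kronRect_five_four]

/-- **BI 2017 Rem. 5.18: `k_12(4) = 5` — PROVED** (`= k_4(4)`). [cite: BurgisserIkenmeyer2017, Rem. 5.18] -/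
theorem kronRect_twelve_four : kronRect ℂ 12 4 = 5 := by
  rw [kronRect_eq_kronRect_of_add_eq_sq (m' := 4) (δ := 4) (by norm_num), kronRect_four_four]

/-- **BI 2017 Rem. 5.18: `k_13(4) = 2` — PROVED** (`= k_3(4) = 2`, Ex. 5.5's value).
[cite: BurgisserIkenmeyer2017, Rem. 5.18] -/
theorem kronRect_thirteen_four : kronRect ℂ 13 4 = 2 := by
  rw [kronRect_eq_kronRect_of_add_eq_sq (m' := 3) (δ := 4) (by norm_num), kronRect_three_four]

/-- **BI 2017 Rem. 5.18: `k_14(4) = 1` — PROVED** (`= k_2(4)`). [cite: BurgisserIkenmeyer2017, Rem. 5.18] -/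
theorem kronRect_fourteen_four : kronRect ℂ 14 4 = 1 := by
  rw [kronRect_eq_kronRect_of_add_eq_sq (m' := 2) (δ := 4) (by norm_num), kronRect_two_four]

/-- **BI 2017 Rem. 5.18: `k_15(4) = 1` — PROVED** (`= k_1(4)`). [cite: BurgisserIkenmeyer2017, Rem. 5.18] -/
theorem kronRect_fifteen_four : kronRect ℂ 15 4 = 1 := by
  rw [kronRect_eq_kronRect_of_add_eq_sq (m' := 1) (δ := 4) (by norm_num), kronRect_one_four]

/-- **`k_9(4) = 14`** (`= k_7(4)`, the tree's kernel value `kronRect_seven_four`); in particular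
the atom `4 ∈ E'(9)` of Ex. 5.6's `E'(9) = {0,3,4,5,6,…}`. [cite: BurgisserIkenmeyer2017, Ex. 5.6] -/
theorem kronRect_nine_four : kronRect ℂ 9 4 = 14 := by
  rw [kronRect_eq_kronRect_of_add_eq_sq (m' := 7) (δ := 4) (by norm_num), kronRect_seven_four]

/-- **BI 2017 Rem. 5.18 / Ex. 5.6, the complete list of values — PROVED**: the last conjunct of
`BI2017_ex_5_6` verbatim (`k_4(2) = k_5(3) = k_6(3) = k_8(3) = k_9(3) = k_14(4) = k_15(4) = k_16(4)
= 1`, `k_7(4) = 14`, `k_10(4) = 13`, `k_11(4) = 6`, `k_12(4) = 5`, `k_13(4) = 2`).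
[cite: BurgisserIkenmeyer2017, Rem. 5.18] -/
theorem BI2017_rem_5_18_values :
    kronRect ℂ 4 2 = 1 ∧ kronRect ℂ 5 3 = 1 ∧ kronRect ℂ 6 3 = 1 ∧ kronRect ℂ 8 3 = 1 ∧
    kronRect ℂ 9 3 = 1 ∧ kronRect ℂ 14 4 = 1 ∧ kronRect ℂ 15 4 = 1 ∧ kronRect ℂ 16 4 = 1 ∧
    kronRect ℂ 7 4 = 14 ∧ kronRect ℂ 10 4 = 13 ∧ kronRect ℂ 11 4 = 6 ∧ kronRect ℂ 12 4 = 5 ∧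
    kronRect ℂ 13 4 = 2 :=
  ⟨BI2017_rem_5_18_squares.1, kronRect_five_three, kronRect_six_three, kronRect_eight_three,
    BI2017_rem_5_18_squares.2.1, kronRect_fourteen_four, kronRect_fifteen_four,
    BI2017_rem_5_18_squares.2.2, kronRect_seven_four, kronRect_ten_four, kronRect_eleven_four,
    kronRect_twelve_four, kronRect_thirteen_four⟩

end RemFiveEighteen

/-! ### 5. Ex. 5.6: `e(10) = 40, …, e(15) = 60` -/

section MinimalDegree

/-- **BI 2017 Ex. 5.6: `e'(10) = 4`, i.e. `e(10) = 40` — PROVED** (`k_10(4) = 13 > 0` and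
`k_10(δ) = 0` for `δ ≤ 3` since `9 < 10`, Thm. 5.9(1)). [cite: BurgisserIkenmeyer2017, Ex. 5.6] -/
theorem BI2017_ex_5_6_ten : genericTensorMinimalDegree (Fin 10) ℂ = 40 :=
  genericTensorMinimalDegree_eq_of_kronRect_pos (m := 10) (δ₀ := 4) (by norm_num) (by norm_num)
    (by rw [kronRect_ten_four]; norm_num) (by norm_num)

/-- **BI 2017 Ex. 5.6: `e(11) = 44` — PROVED** (`k_11(4) = 6 > 0`). [cite: BurgisserIkenmeyer2017, Ex. 5.6] -/
theorem BI2017_ex_5_6_eleven : genericTensorMinimalDegree (Fin 11) ℂ = 44 :=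
  genericTensorMinimalDegree_eq_of_kronRect_pos (m := 11) (δ₀ := 4) (by norm_num) (by norm_num)
    (by rw [kronRect_eleven_four]; norm_num) (by norm_num)

/-- **BI 2017 Ex. 5.6: `e(12) = 48` — PROVED** (`k_12(4) = 5 > 0`). [cite: BurgisserIkenmeyer2017, Ex. 5.6] -/
theorem BI2017_ex_5_6_twelve : genericTensorMinimalDegree (Fin 12) ℂ = 48 :=
  genericTensorMinimalDegree_eq_of_kronRect_pos (m := 12) (δ₀ := 4) (by norm_num) (by norm_num)
    (by rw [kronRect_twelve_four]; norm_num) (by norm_num)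

/-- **BI 2017 Ex. 5.6: `e(13) = 52` — PROVED** (`k_13(4) = 2 > 0`). [cite: BurgisserIkenmeyer2017, Ex. 5.6] -/
theorem BI2017_ex_5_6_thirteen : genericTensorMinimalDegree (Fin 13) ℂ = 52 :=
  genericTensorMinimalDegree_eq_of_kronRect_pos (m := 13) (δ₀ := 4) (by norm_num) (by norm_num)
    (by rw [kronRect_thirteen_four]; norm_num) (by norm_num)

/-- **BI 2017 Ex. 5.6: `e(14) = 56` — PROVED** (`k_14(4) = 1 > 0`). [cite: BurgisserIkenmeyer2017, Ex. 5.6] -/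
theorem BI2017_ex_5_6_fourteen : genericTensorMinimalDegree (Fin 14) ℂ = 56 :=
  genericTensorMinimalDegree_eq_of_kronRect_pos (m := 14) (δ₀ := 4) (by norm_num) (by norm_num)
    (by rw [kronRect_fourteen_four]; norm_num) (by norm_num)

/-- **BI 2017 Ex. 5.6: `e(15) = 60` — PROVED** (`k_15(4) = 1 > 0`). [cite: BurgisserIkenmeyer2017, Ex. 5.6] -/
theorem BI2017_ex_5_6_fifteen : genericTensorMinimalDegree (Fin 15) ℂ = 60 :=
  genericTensorMinimalDegree_eq_of_kronRect_pos (m := 15) (δ₀ := 4) (by norm_num) (by norm_num)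
    (by rw [kronRect_fifteen_four]; norm_num) (by norm_num)

/-- **All fourteen values `e(3), …, e(16)` of BI 2017 Ex. 5.6 — PROVED** (the first fourteen
conjuncts of `BI2017_ex_5_6`). [cite: BurgisserIkenmeyer2017, Ex. 5.6] -/
theorem BI2017_ex_5_6_values :
    genericTensorMinimalDegree (Fin 3) ℂ = 6 ∧ genericTensorMinimalDegree (Fin 4) ℂ = 8 ∧
    genericTensorMinimalDegree (Fin 5) ℂ = 15 ∧ genericTensorMinimalDegree (Fin 6) ℂ = 18 ∧
    genericTensorMinimalDegree (Fin 7) ℂ = 28 ∧ genericTensorMinimalDegree (Fin 8) ℂ = 24 ∧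
    genericTensorMinimalDegree (Fin 9) ℂ = 27 ∧ genericTensorMinimalDegree (Fin 10) ℂ = 40 ∧
    genericTensorMinimalDegree (Fin 11) ℂ = 44 ∧ genericTensorMinimalDegree (Fin 12) ℂ = 48 ∧
    genericTensorMinimalDegree (Fin 13) ℂ = 52 ∧ genericTensorMinimalDegree (Fin 14) ℂ = 56 ∧
    genericTensorMinimalDegree (Fin 15) ℂ = 60 ∧ genericTensorMinimalDegree (Fin 16) ℂ = 64 :=
  ⟨BI2017_ex_5_6_three, BI2017_ex_5_6_four, BI2017_ex_5_6_five, BI2017_ex_5_6_six,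
    BI2017_ex_5_6_seven, BI2017_ex_5_6_eight, BI2017_ex_5_6_nine, BI2017_ex_5_6_ten,
    BI2017_ex_5_6_eleven, BI2017_ex_5_6_twelve, BI2017_ex_5_6_thirteen, BI2017_ex_5_6_fourteen,
    BI2017_ex_5_6_fifteen, BI2017_ex_5_6_sixteen⟩

/-- **`BI2017_ex_5_6` reduced to its one open clause**: the named fact (BI 2017 Ex. 5.6 and
Rem. 5.18 as typed) follows from the shape clause `E(m) = {0} ∪ (e(m) + mℕ)` for `7 ≤ m ≤ 12`
alone — the fourteen values `e(m)`, the shape for `m ≤ 6` (`BI2017_ex_5_6_shape_of_le_six`) and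
the thirteen Kronecker values being theorems of the tree. [cite: BurgisserIkenmeyer2017, Ex. 5.6 and Rem. 5.18] -/
theorem BI2017_ex_5_6_of_shape
    (hshape : ∀ m : ℕ, 7 ≤ m → m ≤ 12 →
      genericTensorDegreeMonoid (Fin m) ℂ =
        {d | d = 0 ∨ ∃ δ : ℕ, d = m * δ ∧ genericTensorMinimalDegree (Fin m) ℂ ≤ m * δ}) :
    BI2017_ex_5_6 := by
  refine ⟨BI2017_ex_5_6_three, BI2017_ex_5_6_four, BI2017_ex_5_6_five, BI2017_ex_5_6_six,
    BI2017_ex_5_6_seven, BI2017_ex_5_6_eight, BI2017_ex_5_6_nine, BI2017_ex_5_6_ten,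
    BI2017_ex_5_6_eleven, BI2017_ex_5_6_twelve, BI2017_ex_5_6_thirteen, BI2017_ex_5_6_fourteen,
    BI2017_ex_5_6_fifteen, BI2017_ex_5_6_sixteen, fun m h3 h12 => ?_, BI2017_rem_5_18_values⟩
  by_cases h6 : m ≤ 6
  · exact BI2017_ex_5_6_shape_of_le_six m h3 h6
  · exact hshape m (by omega) h12

end MinimalDegree

end Literature.Computability.AlgebraicComplexity
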